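/-
COR-CM (cell pub-hodgecm2, stage 2 of the Hodge ladder) — STANDING TRIBUNAL ITEM T5, the W-B ∕ W-C DECIDER RUN (2026-08-23T22:46Z box).
THEOREMS ONLY; nothing landed is edited or restated; no definition, no named fact, no `sorry`.  HC_CM is NOT proved; «Δ2 BRIDGE CLOSED» is NOT claimed.
Seat: pub-hodgecm2-t5-consist-1 gen 62 (referee-pub-hodgecm2-t5-consist-1-g62-0).
-/
import Summits.HodgeConjecture.HodgeCM.Model.HThetaJunctionR2B
import Summits.HodgeConjecture.CorCM.D2Bridge.OrientationT2BlockVanishing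
import HarnessLib

/-!
# T5 at the ISOMETRIC block `j₀`: what {h413′, `hJ_ROGT'C_block`, `thetaOf_subset_H10`, one non-zero theta class} give — and what they do NOT

THE QUESTION (coordinator relay 2026-08-23T22:45:50Z): from the four hypotheses
* `h413′` — [Liu21, Prop. 4.13] AS KEYED in the primed chain, `Prop413AsPrinted ((uniformOmegaRep …).prop413Data (Rekey.liuDictionaryPin …).H)`,
* ✔ `SInstance.hJ_ROGT'C_block` (`HodgeCM/Model/HThetaJunctionR2B.lean` :270 — the ISOMETRIC theta supply: one index `j₀` isometric to the slot
  line and, for every theta class `ω` of the pin `SROGT'C` at every tower level, a tower vector `cf` with `res cf = ω` inside `block j₀`),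
* ✔ `thetaOf_subset_H10` (`HodgeCM/Model/ThetaSideInstance.lean` :190 — theta classes are `(1,0)`),
* one NON-ZERO theta class `ω ≠ 0` (the conclusion shape of `WeilPairData.supply`, `HodgeCM/Model/SupplyResidual.lean` :260),
derive `False`, or say exactly what is missing.

THE ANSWER (kernel, below):
1. **`h413′` cannot enter** — the re-key changes ONLY the two K0 pins `PhiMu` ∕ `adm` of `LiuDictionary.ofTower`; the carrier `H`, the blocks
   and the restriction maps are the SAME (§1, `rfl`, stated for EVERY keying `(PhiMu, adm)` so that the desk's `Rekey.liuDictionaryPin` — not in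
   the tree — is an instance).  `Prop413AsPrinted (… .prop413Data H)` is a `ℂ[G]`-equivariant DECOMPOSITION of that one `H` (`Literature/…/Liu2021/
   Prop413AsPrinted.lean` :202): it carries NO Hodge-type clause, so it is the same proposition on both keyings and contributes nothing to a
   contradiction through the Hodge-type layer (it is displayed below as `_h413`, not consumed).
2. **What the other three DO give** (§2, `t5_obstruction`): at the isometric block `j₀` of slot `i`, a `K`-fixed vector `x ∈ block j₀` with
   `res Γ x = ω ∈ F¹H¹(P_Γ)`, `ω ≠ 0` — hence the typed `(0,1)`-restriction clause (D) at `j₀`,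
   «`∃ Γ₁, ∀ Γ' ≤ Γ₁, ∀ y ∈ block j₀, y K-fixed → res Γ' y ∈ H^{0,1}`», is FALSE (✔ `not_block_pin_res_subset_piece_zero_one_of_res_mem_F_one`).
   That is a NEGATION of a clause, not `False`.
3. **The exact missing lemma** (§3, `t5_inconsistent_of_hD'`): the same four hypotheses PLUS a `(0,1)`-restriction clause `hD'` at the isometric
   block(s) of slot `i` give `False`.  Without `hD'` no contradiction is derivable from the set: three of the four are tree THEOREMS (consistent
   with each other by construction), and the fourth is a decomposition statement without Hodge-type content.

VERDICT: T5 CANNOT — the missing lemma is `hD'` = a displayed or derived `(0,1)`-restriction clause at the ISOMETRIC block `j₀` under the primed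
keying; block disjointness and the ker-`res` door contribute nothing either way (mc-theta-3 g59, cm2 INBOX l.12320 (B)∕(C)).
[cite: VoisinHodgeI2002, §7.3.2] [cite: HatcherAT2002, §3.G Prop. 3G.1] [cite: Liu2021, Prop. 4.13]
-/

set_option autoImplicit false

noncomputable section

open NumberField NumberField.InfinitePlace NumberField.mixedEmbedding IsDedekindDomain
open scoped Matrix Classical TensorProduct SchwartzMap
open MulAction
open Literature.Geometry.ComplexHyperbolic.BallModel (U21 x₀ stabilizerEquivK21)
open Literature.NumberTheory.Automorphic.U21 (K21 matA sclD)
open Literature.AlgebraicGeometry.ShimuraVarieties Literature.AlgebraicGeometry.ShimuraVarieties.BallForms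
open Literature.AlgebraicGeometry.HodgeTheory Literature.NumberTheory.Automorphic.PicardCM
open Literature.NumberTheory.Transcendental (Arapura2012_Cor_15_4_6)
open Literature.NumberTheory.Automorphic Literature.NumberTheory.Automorphic.UnitaryGroup Literature.NumberTheory.Weil1964
open Literature.NumberTheory.GelbartRogawski1991 Literature.NumberTheory.GelbartRogawski1991.UnitaryDualPair
open HodgeCM HodgeCM.Model
open HodgeCM.Adelic HodgeCM.PerL34 HodgeCM.Model.HypCensus HodgeCM.Model.SupplyInstance HodgeCM.Model.ArchSideTerm
open HodgeCM.Model.ThetaSpace HodgeCM.Model.TowerLevel HodgeCM.Model.TowerCarrier HodgeCM.Literature.Theta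
open HodgeCM.Model.ThetaAdelicSide HodgeCM.Model.LiuIndex HodgeCM.Model.SInstance
open Summit.HodgeConjecture.CorCM.D2Bridge

namespace Summit.HodgeConjecture.CorCM.D2Bridge.T5

/-! ## §1 The re-key does not touch `H`, `block`, `res`: keying-independence of the tower-built dictionary (`rfl`) -/

section Keying

variable (hHD : exists_isReal_hodgeModel) (hI : hodgePQ_independent_of_hodgeModel)
  (h₁ : BallQuotientUniformised) (h₃ : CMAbelianVarietyRealised) (hA : Arapura2012_Cor_15_4_6)
variable {L : CMField} {ι₁ : L →+* ℂ} (V : HermSpace3 L ι₁)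
variable (Char : Type) (Adm : Char → Type) (Ω : (μ : Char) → Adm μ → Type)
    [∀ μ a, AddCommGroup (Ω μ a)] [∀ μ a, Module ℂ (Ω μ a)] [∀ μ a, Module (adelicAlgebra V) (Ω μ a)]
    [∀ μ a, IsScalarTower ℂ (adelicAlgebra V) (Ω μ a)]
    (PhiMu PhiMu' : Char → Prop) (adm adm' : Char → LiuCMSide → Prop)

/-- **The carrier is keying-independent**: for ANY two keyings `(PhiMu, adm)`, `(PhiMu', adm')` of the tower-built dictionary (the ported pin
`liuDictionaryPin` reads them at `ι₁`, the desk's `Rekey.liuDictionaryPin` at `ῑ₁`), the carrier `H` is the same tower. [folklore] -/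
theorem ofTower_H_keying_independent :
    (LiuDictionary.ofTower hHD hI h₁ h₃ hA V Char Adm Ω PhiMu adm).H =
      (LiuDictionary.ofTower hHD hI h₁ h₃ hA V Char Adm Ω PhiMu' adm').H := rfl

/-- **The blocks are keying-independent** (`rfl`): a re-key changes which lines are good and which records are admissible, NOT the blocks.
[folklore] -/
theorem ofTower_block_keying_independent :
    (LiuDictionary.ofTower hHD hI h₁ h₃ hA V Char Adm Ω PhiMu adm).block =
      (LiuDictionary.ofTower hHD hI h₁ h₃ hA V Char Adm Ω PhiMu' adm').block := rfl

/-- **The restriction maps are keying-independent** (`rfl`). [folklore] -/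
theorem ofTower_res_keying_independent :
    (LiuDictionary.ofTower hHD hI h₁ h₃ hA V Char Adm Ω PhiMu adm).res =
      (LiuDictionary.ofTower hHD hI h₁ h₃ hA V Char Adm Ω PhiMu' adm').res := rfl

end Keying

/-! ## §2 What the supply gives at the isometric block `j₀`: a non-zero holomorphic `K`-fixed block vector, hence `¬ (D)` at `j₀` -/

section Obstruction

variable (hHD : exists_isReal_hodgeModel) (hI : hodgePQ_independent_of_hodgeModel)
  (h₁ : BallQuotientUniformised) (h₃ : CMAbelianVarietyRealised) (hA : Arapura2012_Cor_15_4_6)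

variable
  (hGR : ∀ {L : CMField} {ι₁ : L →+* ℂ} (V : HermSpace3 L ι₁) (c : SeesawCtx L),
    (cmSplittingDatum (L : Type) finProdFinEquiv (frameD V) (frameD_real V) (frameD_ne V) (dW c.D) (dW_real c.D)
      (dW_ne c.D)).CompatibleSplitting)
  (hGR₀ : ∀ {L : CMField} {ι₁ : L →+* ℂ} (V : HermSpace3 L ι₁) (c : SeesawCtx L),
    (cmSplittingDatum (L : Type) (e₁) (frameD V) (frameD_real V) (frameD_ne V) (lineVec (L : Type) (dW c.D 0))
      (fun _ => dW_real c.D 0) (fun _ => dW_ne c.D 0)).CompatibleSplitting)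
  (hGR₁ : ∀ {L : CMField} {ι₁ : L →+* ℂ} (V : HermSpace3 L ι₁) (c : SeesawCtx L),
    (cmSplittingDatum (L : Type) (e₁) (frameD V) (frameD_real V) (frameD_ne V) (lineVec (L : Type) (dW c.D 1))
      (fun _ => dW_real c.D 1) (fun _ => dW_ne c.D 1)).CompatibleSplitting)
  (hGR₂ : ∀ {L : CMField} {ι₁ : L →+* ℂ} (V : HermSpace3 L ι₁) (c : SeesawCtx L),
    (cmSplittingDatum (L : Type) (e₁) (frameD V) (frameD_real V) (frameD_ne V) (lineVec (L : Type) (dW' c.D 0))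
      (fun _ => dW'_real c.D 0) (fun _ => dW'_ne c.D 0)).CompatibleSplitting)
  (hGR₃ : ∀ {L : CMField} {ι₁ : L →+* ℂ} (V : HermSpace3 L ι₁) (c : SeesawCtx L),
    (cmSplittingDatum (L : Type) (e₁) (frameD V) (frameD_real V) (frameD_ne V) (lineVec (L : Type) (dW' c.D 1))
      (fun _ => dW'_real c.D 1) (fun _ => dW'_ne c.D 1)).CompatibleSplitting)
  (μ : ∀ {L : CMField}, SeesawCtx L → Fin 4 → NumberField.InfinitePlace (L : Type) → ℤ)
  (hΔ₁ : ∀ {L : CMField} {ι₁ : L →+* ℂ} (V : HermSpace3 L ι₁) (c : SeesawCtx L), ∀ hc : GOG V c,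
    slotTypeVec V c (hGR V c) (hGR₀ V c) (hGR₁ V c) (hGR₂ V c) (hGR₃ V c) (hG_GOG V c hc) 1 -
      slotTypeVec V c (hGR V c) (hGR₀ V c) (hGR₁ V c) (hGR₂ V c) (hGR₃ V c) (hG_GOG V c hc) 0 = μ c 1 - μ c 0)
  (hΔ₂ : ∀ {L : CMField} {ι₁ : L →+* ℂ} (V : HermSpace3 L ι₁) (c : SeesawCtx L), ∀ hc : GOG V c,
    slotTypeVec V c (hGR V c) (hGR₀ V c) (hGR₁ V c) (hGR₂ V c) (hGR₃ V c) (hG_GOG V c hc) 2 -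
      slotTypeVec V c (hGR V c) (hGR₀ V c) (hGR₁ V c) (hGR₂ V c) (hGR₃ V c) (hG_GOG V c hc) 0 = μ c 2 - μ c 0)
  (hΔ₃ : ∀ {L : CMField} {ι₁ : L →+* ℂ} (V : HermSpace3 L ι₁) (c : SeesawCtx L), ∀ hc : GOG V c,
    slotTypeVec V c (hGR V c) (hGR₀ V c) (hGR₁ V c) (hGR₂ V c) (hGR₃ V c) (hG_GOG V c hc) 3 -
      slotTypeVec V c (hGR V c) (hGR₀ V c) (hGR₁ V c) (hGR₂ V c) (hGR₃ V c) (hG_GOG V c hc) 0 = μ c 3 - μ c 0)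

variable {L : CMField} {ι₁ : L →+* ℂ} (V : HermSpace3 L ι₁) (c : SeesawCtx L)

/-- A theta class of the pin `SROGT'C` at an anisotropic `V` lies in `F¹H¹(P_Γ)` of the universe (`thetaOf_subset_H10` read through
`thetaSpaceInputOf_of_isAnisotropic` and `classMapDatumOf_H10`). [folklore] -/
theorem thetaOf_pin_mem_F_one (hV : IsAnisotropic L V.Hm) (i : Fin 4) (Γ : Level V)
    (ω : (picardCMUniverse hHD hI h₁ h₃).CohC ((picardCMUniverse hHD hI h₁ h₃).pms L ι₁ V Γ) 1)
    (hω : ω ∈ thetaOf _ (thetaClassInputOf _ (fun V c => thetaSpaceInputOf hHD hI h₁ h₃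
            (SROGT'C @hGR @hGR₀ @hGR₁ @hGR₂ @hGR₃ @μ hΔ₁ hΔ₂ hΔ₃) V c)) V c i Γ) :
    ω ∈ ((picardCMUniverse hHD hI h₁ h₃).hodge ((picardCMUniverse hHD hI h₁ h₃).pms L ι₁ V Γ) 1).F 1 := by
  have h10 : ω ∈ ((thetaSpaceInputOf hHD hI h₁ h₃ (SROGT'C @hGR @hGR₀ @hGR₁ @hGR₂ @hGR₃ @μ hΔ₁ hΔ₂ hΔ₃) V c).D Γ).H10 :=
    thetaOf_subset_H10 _ (thetaClassInputOf _ (fun V c => thetaSpaceInputOf hHD hI h₁ h₃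
      (SROGT'C @hGR @hGR₀ @hGR₁ @hGR₂ @hGR₃ @μ hΔ₁ hΔ₂ hΔ₃) V c)) V c i Γ hω
  rw [thetaSpaceInputOf_of_isAnisotropic hHD hI h₁ h₃ (SROGT'C @hGR @hGR₀ @hGR₁ @hGR₂ @hGR₃ @μ hΔ₁ hΔ₂ hΔ₃) V c hV] at h10
  exact h10

/-- **T5 OBSTRUCTION — what the four hypotheses DO give.**  At the isometric block `j₀` of slot `i` supplied by ✔ `hJ_ROGT'C_block`, every
non-zero theta class `ω` of the pin at a tower level `Γ` lifts to a `K`-fixed vector `x ∈ block j₀` with `res Γ x = ω ∈ F¹`, `ω ≠ 0`; hence the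
typed `(0,1)`-restriction clause (D) at `j₀` is FALSE.  The Prop. 4.13 pin `_h413` (displayed for the record — the primed `h413′` is the same
decomposition of the same `H`, §1) is NOT consumed: it has no Hodge-type content to consume.  This is a negation of (D), not `False`.
[cite: VoisinHodgeI2002, §7.3.2] [cite: HatcherAT2002, §3.G Prop. 3G.1] -/
theorem t5_obstruction (hc : GOG V c) (hV : IsAnisotropic L V.Hm) (i : Fin 4)
    (_h413 : (liuDictionaryPin hHD hI h₁ h₃ hA V
      (LiuIndex.I V (LiuIndex.repAt (⟨c.D.a i, c.D.a_real i, c.D.a_ne i⟩ : LiuIndex.RealScalar L)) (muLiu ι₁ LiuIndex.GramClass.rep))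
      (LiuIndex.line V (LiuIndex.repAt (⟨c.D.a i, c.D.a_real i, c.D.a_ne i⟩ : LiuIndex.RealScalar L))
        (muLiu ι₁ LiuIndex.GramClass.rep))).Prop413)
    (Γ : Level V) (hΓ : Γ.BelowConjThree)
    (ω : (picardCMUniverse hHD hI h₁ h₃).CohC ((picardCMUniverse hHD hI h₁ h₃).pms L ι₁ V Γ) 1)
    (hω : ω ∈ thetaOf _ (thetaClassInputOf _ (fun V c => thetaSpaceInputOf hHD hI h₁ h₃
            (SROGT'C @hGR @hGR₀ @hGR₁ @hGR₂ @hGR₃ @μ hΔ₁ hΔ₂ hΔ₃) V c)) V c i Γ)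
    (hne : ω ≠ 0) :
    ∃ j : LiuIndex.I V (LiuIndex.repAt (⟨c.D.a i, c.D.a_real i, c.D.a_ne i⟩ : LiuIndex.RealScalar L))
        (muLiu ι₁ LiuIndex.GramClass.rep),
      (∃ z : (L : Type), z ≠ 0 ∧
        (LiuIndex.line V (LiuIndex.repAt (⟨c.D.a i, c.D.a_real i, c.D.a_ne i⟩ : LiuIndex.RealScalar L))
          (muLiu ι₁ LiuIndex.GramClass.rep) j).scalar = z * conjRingHomK L z * c.D.a i) ∧
      (∃ x ∈ (liuDictionaryPin hHD hI h₁ h₃ hA V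
          (LiuIndex.I V (LiuIndex.repAt (⟨c.D.a i, c.D.a_real i, c.D.a_ne i⟩ : LiuIndex.RealScalar L)) (muLiu ι₁ LiuIndex.GramClass.rep))
          (LiuIndex.line V (LiuIndex.repAt (⟨c.D.a i, c.D.a_real i, c.D.a_ne i⟩ : LiuIndex.RealScalar L))
            (muLiu ι₁ LiuIndex.GramClass.rep))).block j,
        x ∈ fixedBy Γ.K (liuDictionaryPin hHD hI h₁ h₃ hA V
          (LiuIndex.I V (LiuIndex.repAt (⟨c.D.a i, c.D.a_real i, c.D.a_ne i⟩ : LiuIndex.RealScalar L)) (muLiu ι₁ LiuIndex.GramClass.rep))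
          (LiuIndex.line V (LiuIndex.repAt (⟨c.D.a i, c.D.a_real i, c.D.a_ne i⟩ : LiuIndex.RealScalar L))
            (muLiu ι₁ LiuIndex.GramClass.rep))).H ∧
        (liuDictionaryPin hHD hI h₁ h₃ hA V
          (LiuIndex.I V (LiuIndex.repAt (⟨c.D.a i, c.D.a_real i, c.D.a_ne i⟩ : LiuIndex.RealScalar L)) (muLiu ι₁ LiuIndex.GramClass.rep))
          (LiuIndex.line V (LiuIndex.repAt (⟨c.D.a i, c.D.a_real i, c.D.a_ne i⟩ : LiuIndex.RealScalar L))
            (muLiu ι₁ LiuIndex.GramClass.rep))).res Γ x = ω ∧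
        ω ∈ ((picardCMUniverse hHD hI h₁ h₃).hodge ((picardCMUniverse hHD hI h₁ h₃).pms L ι₁ V Γ) 1).F 1) ∧
      ¬ ∃ Γ₁ : Level V, ∀ Γ' ≤ Γ₁, ∀ y ∈ (liuDictionaryPin hHD hI h₁ h₃ hA V
          (LiuIndex.I V (LiuIndex.repAt (⟨c.D.a i, c.D.a_real i, c.D.a_ne i⟩ : LiuIndex.RealScalar L)) (muLiu ι₁ LiuIndex.GramClass.rep))
          (LiuIndex.line V (LiuIndex.repAt (⟨c.D.a i, c.D.a_real i, c.D.a_ne i⟩ : LiuIndex.RealScalar L))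
            (muLiu ι₁ LiuIndex.GramClass.rep))).block j,
        y ∈ fixedBy Γ'.K (liuDictionaryPin hHD hI h₁ h₃ hA V
          (LiuIndex.I V (LiuIndex.repAt (⟨c.D.a i, c.D.a_real i, c.D.a_ne i⟩ : LiuIndex.RealScalar L)) (muLiu ι₁ LiuIndex.GramClass.rep))
          (LiuIndex.line V (LiuIndex.repAt (⟨c.D.a i, c.D.a_real i, c.D.a_ne i⟩ : LiuIndex.RealScalar L))
            (muLiu ι₁ LiuIndex.GramClass.rep))).H →
          (liuDictionaryPin hHD hI h₁ h₃ hA V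
            (LiuIndex.I V (LiuIndex.repAt (⟨c.D.a i, c.D.a_real i, c.D.a_ne i⟩ : LiuIndex.RealScalar L)) (muLiu ι₁ LiuIndex.GramClass.rep))
            (LiuIndex.line V (LiuIndex.repAt (⟨c.D.a i, c.D.a_real i, c.D.a_ne i⟩ : LiuIndex.RealScalar L))
              (muLiu ι₁ LiuIndex.GramClass.rep))).res Γ' y ∈
            ((picardCMUniverse hHD hI h₁ h₃).hodge ((picardCMUniverse hHD hI h₁ h₃).pms L ι₁ V Γ') 1).piece 0 1 := by
  obtain ⟨j, hj, hfam⟩ := hJ_ROGT'C_block hHD hI h₁ h₃ hA @hGR @hGR₀ @hGR₁ @hGR₂ @hGR₃ @μ hΔ₁ hΔ₂ hΔ₃ V c hc hV i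
  obtain ⟨cf, hres, hblock⟩ := hfam Γ hΓ ω hω
  -- the lifted vector is `K`-fixed (it comes from the level `Γ`)
  have hfix : ofLevel hHD hI (ballQuotientUniformisedDatum_of h₁) h₃ hA Γ hΓ cf ∈
      fixedBy Γ.K (liuDictionaryPin hHD hI h₁ h₃ hA V
        (LiuIndex.I V (LiuIndex.repAt (⟨c.D.a i, c.D.a_real i, c.D.a_ne i⟩ : LiuIndex.RealScalar L)) (muLiu ι₁ LiuIndex.GramClass.rep))
        (LiuIndex.line V (LiuIndex.repAt (⟨c.D.a i, c.D.a_real i, c.D.a_ne i⟩ : LiuIndex.RealScalar L))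
          (muLiu ι₁ LiuIndex.GramClass.rep))).H := by
    rw [fixedBy_ofTower_eq_levelImage V _ _ _ _ _ hHD hI h₁ h₃ hA Γ hΓ]
    exact ofLevel_mem_levelImage hHD hI (ballQuotientUniformisedDatum_of h₁) h₃ hA Γ hΓ cf
  -- the dictionary's `res` at `Γ` of the lifted vector is the tower restriction, i.e. `ω`
  have hresD : (liuDictionaryPin hHD hI h₁ h₃ hA V
      (LiuIndex.I V (LiuIndex.repAt (⟨c.D.a i, c.D.a_real i, c.D.a_ne i⟩ : LiuIndex.RealScalar L)) (muLiu ι₁ LiuIndex.GramClass.rep))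
      (LiuIndex.line V (LiuIndex.repAt (⟨c.D.a i, c.D.a_real i, c.D.a_ne i⟩ : LiuIndex.RealScalar L))
        (muLiu ι₁ LiuIndex.GramClass.rep))).res Γ (ofLevel hHD hI (ballQuotientUniformisedDatum_of h₁) h₃ hA Γ hΓ cf) = ω := by
    show resTotal hHD hI (ballQuotientUniformisedDatum_of h₁) h₃ hA Γ
      (ofLevel hHD hI (ballQuotientUniformisedDatum_of h₁) h₃ hA Γ hΓ cf) = ω
    rw [resTotal_ofLevel hHD hI (ballQuotientUniformisedDatum_of h₁) h₃ hA Γ hΓ cf]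
    exact hres
  have hF : ω ∈ ((picardCMUniverse hHD hI h₁ h₃).hodge ((picardCMUniverse hHD hI h₁ h₃).pms L ι₁ V Γ) 1).F 1 :=
    thetaOf_pin_mem_F_one hHD hI h₁ h₃ @hGR @hGR₀ @hGR₁ @hGR₂ @hGR₃ @μ hΔ₁ hΔ₂ hΔ₃ V c hV i Γ ω hω
  refine ⟨j, hj, ⟨_, hblock, hfix, hresD, hF⟩, ?_⟩
  exact not_block_pin_res_subset_piece_zero_one_of_res_mem_F_one V _ _ hHD hI h₁ h₃ hA j Γ hΓ _ hblock hfix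
    (by rw [hresD]; exact hF) (by rw [hresD]; exact hne)

end Obstruction

/-! ## §3 The exact missing lemma: a `(0,1)`-restriction clause at the isometric block(s) of slot `i` closes the set to `False` -/

section Missing

variable (hHD : exists_isReal_hodgeModel) (hI : hodgePQ_independent_of_hodgeModel)
  (h₁ : BallQuotientUniformised) (h₃ : CMAbelianVarietyRealised) (hA : Arapura2012_Cor_15_4_6)

variable
  (hGR : ∀ {L : CMField} {ι₁ : L →+* ℂ} (V : HermSpace3 L ι₁) (c : SeesawCtx L),
    (cmSplittingDatum (L : Type) finProdFinEquiv (frameD V) (frameD_real V) (frameD_ne V) (dW c.D) (dW_real c.D)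
      (dW_ne c.D)).CompatibleSplitting)
  (hGR₀ : ∀ {L : CMField} {ι₁ : L →+* ℂ} (V : HermSpace3 L ι₁) (c : SeesawCtx L),
    (cmSplittingDatum (L : Type) (e₁) (frameD V) (frameD_real V) (frameD_ne V) (lineVec (L : Type) (dW c.D 0))
      (fun _ => dW_real c.D 0) (fun _ => dW_ne c.D 0)).CompatibleSplitting)
  (hGR₁ : ∀ {L : CMField} {ι₁ : L →+* ℂ} (V : HermSpace3 L ι₁) (c : SeesawCtx L),
    (cmSplittingDatum (L : Type) (e₁) (frameD V) (frameD_real V) (frameD_ne V) (lineVec (L : Type) (dW c.D 1))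
      (fun _ => dW_real c.D 1) (fun _ => dW_ne c.D 1)).CompatibleSplitting)
  (hGR₂ : ∀ {L : CMField} {ι₁ : L →+* ℂ} (V : HermSpace3 L ι₁) (c : SeesawCtx L),
    (cmSplittingDatum (L : Type) (e₁) (frameD V) (frameD_real V) (frameD_ne V) (lineVec (L : Type) (dW' c.D 0))
      (fun _ => dW'_real c.D 0) (fun _ => dW'_ne c.D 0)).CompatibleSplitting)
  (hGR₃ : ∀ {L : CMField} {ι₁ : L →+* ℂ} (V : HermSpace3 L ι₁) (c : SeesawCtx L),
    (cmSplittingDatum (L : Type) (e₁) (frameD V) (frameD_real V) (frameD_ne V) (lineVec (L : Type) (dW' c.D 1))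
      (fun _ => dW'_real c.D 1) (fun _ => dW'_ne c.D 1)).CompatibleSplitting)
  (μ : ∀ {L : CMField}, SeesawCtx L → Fin 4 → NumberField.InfinitePlace (L : Type) → ℤ)
  (hΔ₁ : ∀ {L : CMField} {ι₁ : L →+* ℂ} (V : HermSpace3 L ι₁) (c : SeesawCtx L), ∀ hc : GOG V c,
    slotTypeVec V c (hGR V c) (hGR₀ V c) (hGR₁ V c) (hGR₂ V c) (hGR₃ V c) (hG_GOG V c hc) 1 -
      slotTypeVec V c (hGR V c) (hGR₀ V c) (hGR₁ V c) (hGR₂ V c) (hGR₃ V c) (hG_GOG V c hc) 0 = μ c 1 - μ c 0)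
  (hΔ₂ : ∀ {L : CMField} {ι₁ : L →+* ℂ} (V : HermSpace3 L ι₁) (c : SeesawCtx L), ∀ hc : GOG V c,
    slotTypeVec V c (hGR V c) (hGR₀ V c) (hGR₁ V c) (hGR₂ V c) (hGR₃ V c) (hG_GOG V c hc) 2 -
      slotTypeVec V c (hGR V c) (hGR₀ V c) (hGR₁ V c) (hGR₂ V c) (hGR₃ V c) (hG_GOG V c hc) 0 = μ c 2 - μ c 0)
  (hΔ₃ : ∀ {L : CMField} {ι₁ : L →+* ℂ} (V : HermSpace3 L ι₁) (c : SeesawCtx L), ∀ hc : GOG V c,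
    slotTypeVec V c (hGR V c) (hGR₀ V c) (hGR₁ V c) (hGR₂ V c) (hGR₃ V c) (hG_GOG V c hc) 3 -
      slotTypeVec V c (hGR V c) (hGR₀ V c) (hGR₁ V c) (hGR₂ V c) (hGR₃ V c) (hG_GOG V c hc) 0 = μ c 3 - μ c 0)

variable {L : CMField} {ι₁ : L →+* ℂ} (V : HermSpace3 L ι₁) (c : SeesawCtx L)

/-- **T5, conditional inconsistency — THE MISSING LEMMA NAMED.**  The four hypotheses of the decider run PLUS `hD'` — a typed `(0,1)`-restriction
clause (D) at every index of slot `i` ISOMETRIC to the slot line (the shape of `OrientationT2Inconsistency.false_of_thm418C_pin_of_prop413_of_hD`'s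
`hD`, placed at the isometric block `j₀` that ✔ `hJ_ROGT'C_block` supplies) — give `False`.  Without `hD'` the set yields only §2's negation.
`_h413` is displayed and not consumed (§1: the primed keying leaves `H`, `block`, `res` unchanged and Prop. 4.13 has no Hodge-type clause).
[cite: VoisinHodgeI2002, §7.3.2] [cite: HatcherAT2002, §3.G Prop. 3G.1] -/
theorem t5_inconsistent_of_hD' (hc : GOG V c) (hV : IsAnisotropic L V.Hm) (i : Fin 4)
    (_h413 : (liuDictionaryPin hHD hI h₁ h₃ hA V
      (LiuIndex.I V (LiuIndex.repAt (⟨c.D.a i, c.D.a_real i, c.D.a_ne i⟩ : LiuIndex.RealScalar L)) (muLiu ι₁ LiuIndex.GramClass.rep))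
      (LiuIndex.line V (LiuIndex.repAt (⟨c.D.a i, c.D.a_real i, c.D.a_ne i⟩ : LiuIndex.RealScalar L))
        (muLiu ι₁ LiuIndex.GramClass.rep))).Prop413)
    (Γ : Level V) (hΓ : Γ.BelowConjThree)
    (ω : (picardCMUniverse hHD hI h₁ h₃).CohC ((picardCMUniverse hHD hI h₁ h₃).pms L ι₁ V Γ) 1)
    (hω : ω ∈ thetaOf _ (thetaClassInputOf _ (fun V c => thetaSpaceInputOf hHD hI h₁ h₃
            (SROGT'C @hGR @hGR₀ @hGR₁ @hGR₂ @hGR₃ @μ hΔ₁ hΔ₂ hΔ₃) V c)) V c i Γ)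
    (hne : ω ≠ 0)
    (hD' : ∀ j : LiuIndex.I V (LiuIndex.repAt (⟨c.D.a i, c.D.a_real i, c.D.a_ne i⟩ : LiuIndex.RealScalar L))
        (muLiu ι₁ LiuIndex.GramClass.rep),
      (∃ z : (L : Type), z ≠ 0 ∧
        (LiuIndex.line V (LiuIndex.repAt (⟨c.D.a i, c.D.a_real i, c.D.a_ne i⟩ : LiuIndex.RealScalar L))
          (muLiu ι₁ LiuIndex.GramClass.rep) j).scalar = z * conjRingHomK L z * c.D.a i) →
      ∃ Γ₁ : Level V, ∀ Γ' ≤ Γ₁, ∀ y ∈ (liuDictionaryPin hHD hI h₁ h₃ hA V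
          (LiuIndex.I V (LiuIndex.repAt (⟨c.D.a i, c.D.a_real i, c.D.a_ne i⟩ : LiuIndex.RealScalar L)) (muLiu ι₁ LiuIndex.GramClass.rep))
          (LiuIndex.line V (LiuIndex.repAt (⟨c.D.a i, c.D.a_real i, c.D.a_ne i⟩ : LiuIndex.RealScalar L))
            (muLiu ι₁ LiuIndex.GramClass.rep))).block j,
        y ∈ fixedBy Γ'.K (liuDictionaryPin hHD hI h₁ h₃ hA V
          (LiuIndex.I V (LiuIndex.repAt (⟨c.D.a i, c.D.a_real i, c.D.a_ne i⟩ : LiuIndex.RealScalar L)) (muLiu ι₁ LiuIndex.GramClass.rep))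
          (LiuIndex.line V (LiuIndex.repAt (⟨c.D.a i, c.D.a_real i, c.D.a_ne i⟩ : LiuIndex.RealScalar L))
            (muLiu ι₁ LiuIndex.GramClass.rep))).H →
          (liuDictionaryPin hHD hI h₁ h₃ hA V
            (LiuIndex.I V (LiuIndex.repAt (⟨c.D.a i, c.D.a_real i, c.D.a_ne i⟩ : LiuIndex.RealScalar L)) (muLiu ι₁ LiuIndex.GramClass.rep))
            (LiuIndex.line V (LiuIndex.repAt (⟨c.D.a i, c.D.a_real i, c.D.a_ne i⟩ : LiuIndex.RealScalar L))
              (muLiu ι₁ LiuIndex.GramClass.rep))).res Γ' y ∈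
            ((picardCMUniverse hHD hI h₁ h₃).hodge ((picardCMUniverse hHD hI h₁ h₃).pms L ι₁ V Γ') 1).piece 0 1) :
    False := by
  obtain ⟨j, hj, -, hnotD⟩ :=
    t5_obstruction hHD hI h₁ h₃ hA @hGR @hGR₀ @hGR₁ @hGR₂ @hGR₃ @μ hΔ₁ hΔ₂ hΔ₃ V c hc hV i _h413 Γ hΓ ω hω hne
  exact hnotD (hD' j hj)

end Missing

end Summit.HodgeConjecture.CorCM.D2Bridge.T5

end
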